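import Literature.AlgebraicGeometry.Resolution.RidgeRepresentable
import Literature.AlgebraicGeometry.Resolution.DiffStableTriangular
import Literature.AlgebraicGeometry.Resolution.PointBlowupShade
import Literature.AlgebraicGeometry.Hironaka2017.EdgeInvAnyField
import Mathlib.Algebra.MvPolynomial.Division
import HarnessLib

/-!
# The ridge (faîte) of the cones attached to a point-blow-up state of `x^q + F(y)`:
  Giraud's algebra of invariants, Hironaka's edge datum `(n, n − r, q₁, …, q_r)` of a ridge,
  the Berthomieu–Hivert–Mourtada generating sets, Frühbis-Krüger's n-ridge, and the
  "ridge datum drops / stalls / rises after blow-up" predicates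

Topic: `Literature/AlgebraicGeometry/Resolution`. Statement-level typing — definitions with bodies,
a few proved sanity theorems, published theorems recorded as NAMED FACTS (`def … : Prop`, never
asserted) — of the objects measured by the ridge layer of the point-blow-up atlas of purely
inseparable hypersurfaces `f = x^q + F(y)`, `q = p^e` (`PointBlowupShade.lean`: `PointBlowup.State`,
`PointBlowup.step`, `ShadeIncreases`).

1. **Giraud's algebra of invariants of the ridge and its edge datum.** For an ideal `I ⊆ S = K[X₁,…,Xₙ]`
   with ridge ideal `𝔉 = ridgeIdeal I` (`Ridge.lean`, `RidgeRepresentable.lean`: `F = V(𝔉)` represents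
   Giraud's functor), `ridgeAlgebra p I = K[θ : θ = Σ_k c_k X_k^{p^e} ∈ 𝔉]` is the subalgebra generated
   by the ADDITIVE homogeneous forms of `𝔉` (Giraud 1975 §1.5: "`F` admet pour équations des polynômes
   additifs … Désignons par `U` la sous-algèbre graduée engendrée par ces polynômes"; BHM Lemma 2.7,
   Prop. 2.11, Cor. 2.12). It is graded and Hasse–Schmidt stable (PROVED, from
   `DiffStableTriangular.lean`), so the tree's `edgeInvK` (Hironaka–Giraud triangular basis
   `θ_i = X_i^{p^{α_i}} + t_i`, BHM Prop. 2.11) gives it a well-defined **edge datum**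
   `ridgeEdgeInv p I : EdgeInv n`, Hironaka's `Inv = (n, n − r, q₁, …, q_r)` [Hironaka2017, Eq. (34) p.24]
   of the group `B = Rid`, ordered lexicographically (`Hironaka2017/Datum.lean`). That `𝔉` is generated
   by its additive forms is the named fact `RidgeIdealSpanAdditive` (Giraud §1.5; BHM Lemma 2.6/2.7).
2. **The BHM generating sets of the ridge of ONE homogeneous form `h` of degree `d`** (a principal
   homogeneous ideal is its own Giraud basis, BHM Def. 2.4: `exp(h·S) = exp h + ℕⁿ`):
   `hasseCoefficients d h = 𝓔 = {D_A h : |A| < d}` and `hasseCoefficientsPPow p d h = 𝓔_p` (those of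
   `p`-power degree); named facts `PrincipalRidgeIdealEqSpanHasse` (BHM Cor. 2.3, after Giraud) and
   `PrincipalRidgeIdealEqSpanHassePPow` (BHM Lemma 3.6) — the correctness statements of BHM's
   Algorithms 3.3 / 3.10, which return the reduced Gröbner basis of `(𝓔_p)`; by BHM Prop. 3.9 / 2.11 it
   consists of additive polynomials in triangular form, i.e. it is a `TriangularPresentation`
   (`EdgeInvAnyField.lean`) of `ridgeAlgebra`.
3. **The cones of an atlas state `s = (F, r)`** of `x^q + F(y)`, `y = (y₁,…,y_m)`:
   `tangentForm q s = x^q + [F]_q` (the tangent cone of the hypersurface at a `q`-fold point),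
   `initialForm s = in_{ord F} F` (the first coefficient — exceptional monomial `y^r` included),
   `residualFactor s = y^{−r} F` (Hauser's `g`, `f = x^p + y^r g`), `residualForm s = in(g)`, and
   Frühbis-Krüger's **n-ridge** object `nResidualForm q s = in(g)^{(q−1)!}` — the lowest-order generator
   of the non-monomial part of the first coefficient ideal in the Bravo–Encinas–Villamayor normalisation
   (power `c!/(c − i)` of the coefficient of `x^i`, here `i = 0`, `c = q`) [FruehbisKrueger2010, §2,
   Example 1 and Remark 4]; their ridge data `tangentRidgeInv`, `coefficientRidgeInv`,
   `residualRidgeInv`, `nRidgeInv`.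
4. **Predicates.** `RidgeGeneratedInDegreeOne v` ("the ridge is generated by polynomials of degree
   one", FK2010 §2 — in Hironaka's datum: all `q_j = 1`; equivalently `Rid = Dir` as schemes);
   the edge predicates `ResidualRidgeDrops / Stalls / Rises` (lexicographic comparison of the residual
   ridge datum before and after `PointBlowup.step`), and Frühbis-Krüger's sharpened kangaroo
   conditions as PREDICATES on (state, chart, point): `FKSharpenedA` ("the ridge must at least have one
   generator in higher degree") and the HOPED-FOR `FKSharpenedB` ("there is hope to use this new ridge …
   to slightly sharpen item (b)": a shade increase forces the n-ridge of the antelope state not to be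
   generated in degree one) — the latter is an open suggestion of [FruehbisKrueger2010], typed here so
   that a census can confirm or refute instances; NOTHING in this file asserts it.

Junk values (documented at each use): `(ord₀ F).toNat = 0` for `F = 0`; `divMonomial` discards the
monomials not divisible by `y^r` (none when `y^r ∣ F`, the standing situation of the walk);
`tangentForm` is the tangent cone only at a `q`-fold point (`q ≤ ord₀ F`).

## References

* J. Giraud, *Contact maximal en caractéristique positive*, Ann. Sci. ÉNS (4) 8 (1975) 201–234, §1.5–1.6. [Giraud1975]
* J. Berthomieu, P. Hivert, H. Mourtada, *Computing Hironaka's invariants: ridge and directrix*,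
  Contemp. Math. 521 (2010) 9–20: Def. 1.1/1.2, Cor. 2.3, Def. 2.4, Lemma 2.6/2.7, Prop. 2.11,
  Cor. 2.12, Lemma 3.6, Prop. 3.9, Alg. 3.10, Rem. 3.12. [BerthomieuHivertMourtada2010]
* A. Frühbis-Krüger, *A short note on Hauser's Kangaroo phenomena and weak maximal contact in higher
  dimensions*, J. Singul. 2 (2010) 128–142 = arXiv:1007.2203, §2 (ridge, n-ridge, Remark 4). [FruehbisKrueger2010]
* H. Hironaka, *Resolution of singularities in positive characteristics* (manuscript, 2017), Eq. (34)
  p.24 (`Inv_ξ(E) = (n, n − r, q₁, …, q_r)`), Th. 16.6 (2) p.84 (lexicographic comparison). [Hironaka2017]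
* H. Hauser, *On the problem of resolution of singularities in positive characteristic*,
  Bull. AMS 47 (2010), §§F–G. [Hauser2010]
-/

noncomputable section

open MvPolynomial
open scoped BigOperators

namespace Literature.AlgebraicGeometry.Resolution

open Literature.AlgebraicGeometry.Hironaka2017.Datum
open Literature.AlgebraicGeometry.Hironaka2017.EdgeAlgebra

universe u

variable {K : Type u} [Field K] {n : ℕ}

/-! ## 1. The additive forms of the ridge ideal, Giraud's algebra `U`, and its edge datum -/

/-- Index set of the **additive homogeneous forms of the ridge ideal** in exponential characteristic
`p`: the pairs `(c, e)` with `Σ_k c_k X_k^{p^e} ∈ 𝔉(I)` (Giraud 1975 §1.5: the equations of `F` are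
additive polynomials; BHM Def. 1.2: additive = `Σ λ_i X_i^{p^{r_i}}`, homogeneous ones have one
exponent). [cite: Giraud1975, §1.5] -/
def RidgeFormIndex (p : ℕ) (I : Ideal (MvPolynomial (Fin n) K)) : Type u :=
  {ce : (Fin n → K) × ℕ // (∑ k, C (ce.1 k) * X k ^ p ^ ce.2 : MvPolynomial (Fin n) K) ∈ ridgeIdeal I}

/-- The additive form `Σ_k c_k X_k^{p^e}` indexed by `(c, e)`. [cite: BerthomieuHivertMourtada2010, Def. 1.2] -/
def ridgeForm (p : ℕ) (I : Ideal (MvPolynomial (Fin n) K)) (j : RidgeFormIndex p I) :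
    MvPolynomial (Fin n) K :=
  ∑ k, C (j.1.1 k) * X k ^ p ^ j.1.2

/-- **Giraud's algebra of invariants `U` of the ridge**: the subalgebra of `S` generated by the additive
homogeneous forms lying in the ridge ideal `𝔉(I)` ("Désignons par `U` la sous-algèbre graduée de `O_V`
engendrée par ces polynômes", Giraud 1975 §1.5; BHM Lemma 2.7 / Cor. 2.12: `U = k[θ₁, …, θ_e]`,
`I = (I ∩ U) S`). [cite: Giraud1975, §1.5] -/
def ridgeAlgebra (p : ℕ) (I : Ideal (MvPolynomial (Fin n) K)) : Subalgebra K (MvPolynomial (Fin n) K) :=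
  Algebra.adjoin K (Set.range (ridgeForm p I))

variable {p : ℕ} {I : Ideal (MvPolynomial (Fin n) K)}

/-- The generators of `U` lie in `𝔉`. [cite: Giraud1975, §1.5] -/
theorem ridgeForm_mem_ridgeIdeal (j : RidgeFormIndex p I) : ridgeForm p I j ∈ ridgeIdeal I :=
  j.2

variable (p I) in
/-- `U ∩ S₊`-generators lie in `𝔉`: the algebra `U` is generated inside `K + 𝔉`, precisely
`Set.range (ridgeForm p I) ⊆ 𝔉`. [cite: Giraud1975, §1.5] -/
theorem range_ridgeForm_subset : Set.range (ridgeForm p I) ⊆ (ridgeIdeal I : Set (MvPolynomial (Fin n) K)) := by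
  rintro _ ⟨j, rfl⟩
  exact ridgeForm_mem_ridgeIdeal j

variable (p I) in
/-- **`U` is graded** (generated by homogeneous elements). PROVED. [cite: Giraud1975, §1.5] -/
theorem isGradedSubalgebra_ridgeAlgebra : IsGradedSubalgebra (ridgeAlgebra p I) :=
  isGradedSubalgebra_adjoin_sum_C_mul_X_pow (fun j : RidgeFormIndex p I => j.1.1) fun j => p ^ j.1.2

variable (p I) in
/-- **`U` is stable under all Hasse–Schmidt derivations** (BHM Prop. 2.10: `D_A G ∈ I ∩ k[θ]`;
Giraud Lemme 1.7). PROVED for the algebra generated by additive forms. [cite: BerthomieuHivertMourtada2010, Prop. 2.10] -/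
theorem isDiffStable_ridgeAlgebra [ExpChar K p] : IsDiffStable (ridgeAlgebra p I) :=
  isDiffStable_adjoin_sum_C_mul_X_pow p (fun j : RidgeFormIndex p I => j.1.1) fun j => j.1.2

variable (p I) in
/-- **Hironaka's edge datum of the ridge**, `Inv = (n, n − r, q₁, …, q_r)` with `q₁ ≤ … ≤ q_r` the
`p`-power degrees of a triangular additive basis `θ_i = X_i^{q_i} + t_i` of `U` (BHM Prop. 2.11;
Hironaka 2017 Eq. (34) p.24 for `B = Rid`), as the tree's well-defined `edgeInvK` of the graded,
differentially stable algebra `U = ridgeAlgebra p I`; `n − r = dim Rid` when `𝔉 = U₊S`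
(`RidgeIdealSpanAdditive`). [cite: Hironaka2017, Eq. (34) p.24] -/
def ridgeEdgeInv [ExpChar K p] : EdgeInv n :=
  edgeInvK p (ridgeAlgebra p I) (isGradedSubalgebra_ridgeAlgebra p I) (isDiffStable_ridgeAlgebra p I)

variable (p I) in
/-- NAMED FACT (Giraud 1975 §1.5 "F admet pour équations des polynômes additifs"; BHM Lemma 2.6 /
2.7 and Cor. 2.12): **the ideal of the ridge is generated by the additive homogeneous forms it
contains**, `𝔉 = ⟨θ : θ additive homogeneous, θ ∈ 𝔉⟩`. Not proved in the tree. [cite: Giraud1975, §1.5] -/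
def RidgeIdealSpanAdditive : Prop :=
  ridgeIdeal I = Ideal.span (Set.range (ridgeForm p I))

/-! ## 2. The Berthomieu–Hivert–Mourtada generating sets for one homogeneous form -/

/-- **`𝓔(h) = {D_A h : |A| < d}`**, the Hasse–Schmidt coefficients of a form `h` of degree `d`
(BHM §2.2: "`𝓔 = {D_A f_i, i ∈ Δ, |A| < d_i}`"; for the principal homogeneous ideal `(h)`, which is
its own Giraud basis, Def. 2.4). [cite: BerthomieuHivertMourtada2010, Cor. 2.3] -/
def hasseCoefficients (d : ℕ) (h : MvPolynomial (Fin n) K) : Set (MvPolynomial (Fin n) K) :=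
  {g | ∃ A : Fin n →₀ ℕ, A.degree < d ∧ g = hasseDeriv K A h}

/-- **`𝓔_p(h)`**: the Hasse–Schmidt coefficients `D_A h`, `|A| < d`, whose degree `d − |A|` is a power
of `p` (`p⁰ = 1` included) (BHM Lemma 3.6: "`𝓔_p = {ψ ∈ 𝓔 | ∃ j ∈ ℕ, deg ψ = p^j}`").
[cite: BerthomieuHivertMourtada2010, Lemma 3.6] -/
def hasseCoefficientsPPow (p d : ℕ) (h : MvPolynomial (Fin n) K) : Set (MvPolynomial (Fin n) K) :=
  {g | ∃ A : Fin n →₀ ℕ, A.degree < d ∧ (∃ j : ℕ, d - A.degree = p ^ j) ∧ g = hasseDeriv K A h}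

/-- `𝓔_p ⊆ 𝓔`. [cite: BerthomieuHivertMourtada2010, Lemma 3.6] -/
theorem hasseCoefficientsPPow_subset (p d : ℕ) (h : MvPolynomial (Fin n) K) :
    hasseCoefficientsPPow p d h ⊆ hasseCoefficients d h := by
  rintro g ⟨A, hA, -, rfl⟩
  exact ⟨A, hA, rfl⟩

/-- `h = D_0 h ∈ 𝓔(h)` for `d ≥ 1`. [cite: BerthomieuHivertMourtada2010, Cor. 2.3] -/
theorem self_mem_hasseCoefficients {d : ℕ} (hd : 0 < d) (h : MvPolynomial (Fin n) K) :
    h ∈ hasseCoefficients d h := by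
  refine ⟨0, by simpa using hd, ?_⟩
  rw [hasseDeriv_zero, LinearMap.id_apply]

variable (K n) in
/-- NAMED FACT (**BHM Cor. 2.3, after Giraud**, principal case): for a nonzero form `h` of degree
`d`, the ideal of the ridge of the cone `V(h)` is generated by `𝓔(h)`: `𝔉((h)) = ⟨D_A h : |A| < d⟩`.
("Let `(f₁,…,f_r)` be a Giraud basis of `I`, `𝓔 = {D_A f_i, |A| < d_i}`, and let `J` be the ideal
generated by `𝓔`; then `J` is the ideal of the ridge of `I`.") Not proved in the tree.
[cite: BerthomieuHivertMourtada2010, Cor. 2.3] -/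
def PrincipalRidgeIdealEqSpanHasse : Prop :=
  ∀ (d : ℕ) (h : MvPolynomial (Fin n) K), h.IsHomogeneous d → h ≠ 0 →
    ridgeIdeal (Ideal.span {h}) = Ideal.span (hasseCoefficients d h)

variable (K n) in
/-- NAMED FACT (**BHM Lemma 3.6**, principal case, `char K = p > 0`): already the `p`-power-degree
coefficients generate, `𝔉((h)) = ⟨𝓔_p(h)⟩` — the correctness statement of BHM Algorithm 3.10 (whose
output, the reduced Gröbner basis of `⟨𝓔_p⟩`, consists of additive polynomials in triangular form by
Prop. 3.9 / Prop. 2.11). Not proved in the tree. [cite: BerthomieuHivertMourtada2010, Lemma 3.6] -/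
def PrincipalRidgeIdealEqSpanHassePPow (p : ℕ) : Prop :=
  ∀ (d : ℕ) (h : MvPolynomial (Fin n) K), h.IsHomogeneous d → h ≠ 0 →
    ridgeIdeal (Ideal.span {h}) = Ideal.span (hasseCoefficientsPPow p d h)

/-- The two named facts are compatible: Lemma 3.6 implies Cor. 2.3's generation statement in the weak
form `𝔉 ⊆ ⟨𝓔⟩` (since `𝓔_p ⊆ 𝓔`). PROVED bookkeeping. [cite: BerthomieuHivertMourtada2010, Lemma 3.6] -/
theorem ridgeIdeal_le_span_hasseCoefficients_of (p : ℕ) (hp : PrincipalRidgeIdealEqSpanHassePPow K n p)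
    {d : ℕ} {h : MvPolynomial (Fin n) K} (hh : h.IsHomogeneous d) (h0 : h ≠ 0) :
    ridgeIdeal (Ideal.span {h}) ≤ Ideal.span (hasseCoefficients d h) := by
  rw [hp d h hh h0]
  exact Ideal.span_mono (hasseCoefficientsPPow_subset p d h)

/-! ## 3. "Generated in degree one" and the lexicographic movement of a ridge datum -/

/-- **The ridge is generated by polynomials of degree one** (FK2010 §2: "In characteristic zero the
ridge is always generated by polynomials of degree one; in positive characteristic the occurrence of a
ridge not generated by polynomials of degree one marks a point for which the reasoning of
characteristic zero might break down"): in Hironaka's datum, every edge exponent is `q_j = 1`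
(equivalently `Rid = Dir` as schemes, BHM Rem. 2.8 / Rem. 3.12). [cite: FruehbisKrueger2010, §2] -/
def RidgeGeneratedInDegreeOne (v : EdgeInv n) : Prop :=
  ∀ x ∈ v.q, x = 1

/-- `RidgeGeneratedInDegreeOne` is decidable (a finite conjunction over the exponent list). [folklore] -/
instance (v : EdgeInv n) : Decidable (RidgeGeneratedInDegreeOne v) :=
  inferInstanceAs (Decidable (∀ x ∈ v.q, x = 1))

/-- `RidgeGeneratedInDegreeOne v` iff the exponent list is `(1, …, 1)` (`r` ones). [cite: FruehbisKrueger2010, §2] -/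
theorem ridgeGeneratedInDegreeOne_iff (v : EdgeInv n) :
    RidgeGeneratedInDegreeOne v ↔ v.q = List.replicate v.r 1 := by
  rw [RidgeGeneratedInDegreeOne, EdgeInv.r, List.eq_replicate_iff]
  simp

/-- **FK's "rather weak indicator"** of possible new characteristic-`p` phenomena: the largest degree
of a generator of the ridge (FK2010 §3: "the degree of the generators of the ridge can still be used
as a rather weak indicator"); `0` for the empty datum. [cite: FruehbisKrueger2010, §3] -/
def ridgeTopDegree (v : EdgeInv n) : ℕ :=
  v.q.foldr max 0

/-! ## 4. The cones of a point-blow-up state of `x^q + F(y)` and their ridge data -/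

namespace PointBlowup

variable {m : ℕ}

/-- **L1 — the tangent form** `x^q + [F]_q ∈ K[x, y₁, …, y_m]` (`x = X 0`, `y_i = X i.succ`;
`[F]_q` the degree-`q` homogeneous component of `F`, zero when `ord₀ F > q`): the tangent cone of
the hypersurface `x^q + F = 0` at the origin when this is a `q`-fold point (`q ≤ ord₀ F`; for
`ord₀ F < q` it is NOT the tangent cone — junk, flagged in the atlas). [cite: FruehbisKrueger2010, §2] -/
def tangentForm (q : ℕ) (s : State (Fin m) K) : MvPolynomial (Fin (m + 1)) K :=
  X 0 ^ q + rename Fin.succ (homogeneousComponent q s.F)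

/-- **L2 — the initial form `in_d F`, `d = ord₀ F`, of the first coefficient** (exceptional monomial
`y^r` included; `d.toNat = 0`, i.e. the constant term, for the terminal `F = 0`). [cite: Hauser2010, §F (setting f = x^p + y^r g)] -/
def initialForm (s : State (Fin m) K) : MvPolynomial (Fin m) K :=
  homogeneousComponent (Hauser2010.ordZero s.F).toNat s.F

/-- **Hauser's residual factor `g = y^{−r} F`** of the state `(F, r)` ("`f = x^p + y^r·g(y)`",
Hauser 2010 §F): division by the exceptional monomial, `MvPolynomial.divMonomial` (exact when
`y^r ∣ F`, the standing situation; otherwise the non-divisible monomials are discarded — junk).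
[cite: Hauser2010, §F (setting f = x^p + y^r g)] -/
def residualFactor (s : State (Fin m) K) : MvPolynomial (Fin m) K :=
  MvPolynomial.divMonomial s.F s.r

/-- **L3 — the residual form `in(g)`**, the initial form of the residual factor (its degree is the
shade `ord₀ g = ord₀ F − |r|`). [cite: Hauser2010, §F (definition of the shade)] -/
def residualForm (s : State (Fin m) K) : MvPolynomial (Fin m) K :=
  homogeneousComponent (Hauser2010.ordZero (residualFactor s)).toNat (residualFactor s)

/-- **L3′ — Frühbis-Krüger's n-ridge object** for `x^q + F`: the lowest-order generator of the
NON-MONOMIAL part of the first coefficient ideal in the normalisation where the coefficient of `x^i`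
enters with the power `c!/(c − i)` (`c = q`, `i = 0`: the power `(q − 1)!` of `g`; FK2010 Example 1:
for `x³ + z¹⁴w¹⁰(z⁶ − w⁶)` the non-monomial part is `⟨(z⁶ − w⁶)²⟩ = ⟨z¹² + z⁶w⁶ + w¹²⟩`), whose ridge is
the **n-ridge** (Remark 4: "the ridge of the ideal generated by the lowest order generators … of the
non-monomial part of the respective coefficient ideal"). [cite: FruehbisKrueger2010, §2 Remark 4] -/
def nResidualForm (q : ℕ) (s : State (Fin m) K) : MvPolynomial (Fin m) K :=
  residualForm s ^ (q - 1).factorial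

/-- `x^q + [F]_q` is a form of degree `q` (the tangent cone of a `q`-fold point is a cone). [cite: FruehbisKrueger2010, §2] -/
theorem isHomogeneous_tangentForm (q : ℕ) (s : State (Fin m) K) : (tangentForm q s).IsHomogeneous q := by
  refine IsHomogeneous.add ?_ (IsHomogeneous.rename_isHomogeneous (homogeneousComponent_isHomogeneous q s.F))
  simpa using (isHomogeneous_X K (0 : Fin (m + 1))).pow q

/-- `in_d F` is a form of degree `d = ord₀ F`. [cite: Hauser2010, §F (setting f = x^p + y^r g)] -/
theorem isHomogeneous_initialForm (s : State (Fin m) K) :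
    (initialForm s).IsHomogeneous (Hauser2010.ordZero s.F).toNat :=
  homogeneousComponent_isHomogeneous _ _

/-- `in(g)^{(q−1)!}` is a form of degree `ord₀(g)·(q−1)!` (FK2010 Example 1: `(z⁶ − w⁶)²` of degree 12). [cite: FruehbisKrueger2010, §2 Remark 4] -/
theorem isHomogeneous_nResidualForm (q : ℕ) (s : State (Fin m) K) :
    (nResidualForm q s).IsHomogeneous ((Hauser2010.ordZero (residualFactor s)).toNat * (q - 1).factorial) :=
  (homogeneousComponent_isHomogeneous _ _).pow _

variable (p : ℕ) [ExpChar K p]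

/-- **Ridge datum of the tangent cone (L1)**: Hironaka's `Inv` of the ridge of `V(x^q + [F]_q) ⊆ 𝔸^{m+1}`.
[cite: Hironaka2017, Eq. (34) p.24] -/
def tangentRidgeInv (q : ℕ) (s : State (Fin m) K) : EdgeInv (m + 1) :=
  ridgeEdgeInv p (Ideal.span {tangentForm q s})

/-- **Ridge datum of the first coefficient's initial form (L2)**, in `𝔸^m`. [cite: Hironaka2017, Eq. (34) p.24] -/
def coefficientRidgeInv (s : State (Fin m) K) : EdgeInv m :=
  ridgeEdgeInv p (Ideal.span {initialForm s})

/-- **Ridge datum of the residual cone `V(in g)` (L3)**, in `𝔸^m`. [cite: Hironaka2017, Eq. (34) p.24] -/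
def residualRidgeInv (s : State (Fin m) K) : EdgeInv m :=
  ridgeEdgeInv p (Ideal.span {residualForm s})

/-- **Frühbis-Krüger's n-ridge datum (L3′)**: the edge datum of the ridge of `V(in(g)^{(q−1)!})`.
[cite: FruehbisKrueger2010, §2 Remark 4] -/
def nRidgeInv (q : ℕ) (s : State (Fin m) K) : EdgeInv m :=
  ridgeEdgeInv p (Ideal.span {nResidualForm q s})

/-! ### Edge predicates of the ridge layer of the atlas -/

variable [DecidableEq K]

/-- The residual ridge datum **drops** (gets lexicographically smaller in Hironaka's order on
`(m, m − r, q₁, …, q_r, 0, …)`: more generators or lower exponents) at the point `b` of the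
`y_j`-chart. [cite: Hironaka2017, Th. 16.6 (2) p.84] -/
def ResidualRidgeDrops (q : ℕ) (j : Fin m) (b : Fin m → K) (s : State (Fin m) K) : Prop :=
  residualRidgeInv p (step q j b s) < residualRidgeInv p s

/-- The residual ridge datum **stalls** (is unchanged) at the point. [cite: Hironaka2017, Th. 16.6 (2) p.84] -/
def ResidualRidgeStalls (q : ℕ) (j : Fin m) (b : Fin m → K) (s : State (Fin m) K) : Prop :=
  residualRidgeInv p (step q j b s) = residualRidgeInv p s

/-- The residual ridge datum **rises** (gets lexicographically larger) at the point. [cite: Hironaka2017, Th. 16.6 (2) p.84] -/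
def ResidualRidgeRises (q : ℕ) (j : Fin m) (b : Fin m → K) (s : State (Fin m) K) : Prop :=
  residualRidgeInv p s < residualRidgeInv p (step q j b s)

/-- The tangent-cone ridge datum (L1, Hironaka's `Inv` of the hypersurface's ridge) **drops** at the
point. [cite: Hironaka2017, Th. 16.6 (2) p.84] -/
def TangentRidgeDrops (q : ℕ) (j : Fin m) (b : Fin m → K) (s : State (Fin m) K) : Prop :=
  tangentRidgeInv p q (step q j b s) < tangentRidgeInv p q s

/-- **Frühbis-Krüger's sharpened condition (a)** as a predicate on (state, chart, point): a shade
increase (kangaroo) at `b` requires that the ridge of the tangent cone of the hypersurface at the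
antelope state "must at least have one generator in higher degree, i.e. in some degree `p^e`"
(FK2010 §2). For `x^q + F` with `q > 1` a `q`-fold point always has the generator `x^q + …`, so the
content is in the other levels; typed for completeness. [cite: FruehbisKrueger2010, §2] -/
def FKSharpenedA (q : ℕ) (j : Fin m) (b : Fin m → K) (s : State (Fin m) K) : Prop :=
  ShadeIncreases q j b s → ¬ RidgeGeneratedInDegreeOne (tangentRidgeInv p q s)

/-- **Frühbis-Krüger's HOPED-FOR sharpening of Hauser's condition (b)** ("if we only consider the
ridge of the ideal which is generated precisely by the lowest-order generators … then there is hope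
to use this new ridge for ideals and maybe even to slightly sharpen item (b) in Hauser's condition
for kangaroo points", FK2010 §2 before Remark 4): a shade increase at `b` forces the n-ridge of the
antelope state NOT to be generated in degree one. An open suggestion, typed as a predicate so that
instances can be confirmed or refuted by computation; not asserted. [cite: FruehbisKrueger2010, §2 Remark 4] -/
def FKSharpenedB (q : ℕ) (j : Fin m) (b : Fin m → K) (s : State (Fin m) K) : Prop :=
  ShadeIncreases q j b s → ¬ RidgeGeneratedInDegreeOne (nRidgeInv p q s)

/-- The residual-cone variant of `FKSharpenedB` (n-ridge replaced by the ridge of `V(in g)` itself,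
i.e. without the Bravo–Encinas–Villamayor power; the two coincide for `q = 2`, `(q−1)! = 1`).
[cite: FruehbisKrueger2010, §2 Remark 4] -/
def FKSharpenedBResidual (q : ℕ) (j : Fin m) (b : Fin m → K) (s : State (Fin m) K) : Prop :=
  ShadeIncreases q j b s → ¬ RidgeGeneratedInDegreeOne (residualRidgeInv p s)

omit [DecidableEq K] in
/-- For `q = 2` the n-ridge object is the residual form itself (`(2−1)! = 1`). [cite: FruehbisKrueger2010, §2 Remark 4] -/
theorem nResidualForm_two (s : State (Fin m) K) : nResidualForm 2 s = residualForm s := by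
  simp [nResidualForm]

/-- Hironaka's comparison is total (lexicographic on the padded keys, Th. 16.6 (2) p.84), so along every
edge the residual ridge datum drops, stalls or rises. [cite: Hironaka2017, Th. 16.6 (2) p.84] -/
theorem residualRidge_trichotomy (q : ℕ) (j : Fin m) (b : Fin m → K) (s : State (Fin m) K) :
    ResidualRidgeDrops p q j b s ∨ ResidualRidgeStalls p q j b s ∨ ResidualRidgeRises p q j b s := by
  unfold ResidualRidgeDrops ResidualRidgeStalls ResidualRidgeRises
  rcases lt_trichotomy (residualRidgeInv p (step q j b s)).key (residualRidgeInv p s).key with h | h | h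
  · exact Or.inl h
  · exact Or.inr (Or.inl (EdgeInv.key_injective h))
  · exact Or.inr (Or.inr h)

end PointBlowup

end Literature.AlgebraicGeometry.Resolution

end
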